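import Mathlib.RingTheory.MvPolynomial.Tower
import Mathlib.Data.Fintype.EquivFin
import Literature.Computability.AlgebraicComplexity.VonZurGathenRegularityProofs
import Literature.LinearAlgebra.Matrix.PermanentSubperm
import HarnessLib

/-!
# von zur Gathen 1987, Lemma 2.3: proof of the named fact `vonzurGathen1987_singPerm_height`

Topic `Literature/Computability/AlgebraicComplexity`; companion of `VonZurGathenRegularity.lean`
(and of `VonZurGathenRegularityProofs.lean`, which discharges its other named fact by Eagon's
theorem).  That file vendors J. von zur Gathen, *Permanent and determinant* (1987), **Lemma 2.3**
("Let `n ≥ 3`, and `F` be algebraically closed [of characteristic `≠ 2`]. Then every irreducible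
component of `sing P_n` has dimension at most `n² − 5`") as the named fact
`vonzurGathen1987_singPerm_height` in HEIGHT FORM: every prime `P ⊇ (per_m, ∂per_m/∂x_ij)` of
`K[x_ij]` has height `≥ 5`.  This file proves it (`vonzurGathen1987_singPerm_height_holds`),
following the printed proof (p. 91–92) but with two changes of bookkeeping that avoid all
dimension theory, and records the now unconditional Thm. 3.1
(`vonzurGathen1987_perm_detRepr_rank_holds`):

* **generic point instead of components.** `P = ker (f ↦ f(a))` for the point `a = (x_ij mod P)`
  over the domain `L = K[x]/P`; the hypothesis says that all `(m-1) × (m-1)` subpermanents of the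
  matrix `a` vanish (`pderiv_perPoly`: `∂ per/∂x_{rc} = per x(r|c)`).
* **explicit chains instead of `dim`.** For `T` a set of coordinates let `a^T` be `a` with the
  coordinates in `T` replaced by indeterminates (a point over `L[X]`) and `Q_T = ker (f ↦ f(a^T))`,
  a prime with `Q_{T'} ⊆ Q_T` for `T ⊆ T'` and `Q_∅ = P` (`chainIdeal`); a polynomial vanishing
  at `a^T` but not at `a^{T ∪ x}` makes the inclusion strict, so each freed coordinate adds `1`
  to the height (`height_chainIdeal_insert`, via `Ideal.height_add_one_le_of_lt_of_isPrime`).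

With this, vzG's argument runs as printed.  Let `k ≤ m - 2` be maximal such that some `k × k`
subpermanent `g = per[Rw | Cl](a)` is nonzero (so all `(k+1) × (k+1)` ones vanish; vzG treats
`k = m - 2` and sends the rest to an induction on `m`, which the maximal `k` replaces).  If
`k = 0` then `a = 0` and the `m² ≥ 9` coordinates give height `≥ 9` (`card_le_height_ker_aeval`).
Otherwise pick spare rows `i₁ ≠ i₂ ∉ Rw`, spare columns `j₁ ≠ j₂ ∉ Cl` and `j₃ ∈ Cl`:

* the four partials `per[Rw ∪ i' | Cl ∪ j'](a) = 0` expanded along the row `i'` read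
  `a_{i'j'} · g(a) + (terms avoiding the block) = 0` (vzG: "`x_{n-1,n-1}` is a rational function
  on `C` of the `n² − 4` variables …"), so freeing the block `{i₁,i₂} × {j₁,j₂}` one coordinate
  at a time gives `Q_B < ⋯ < Q_∅ = P`, four strict steps (`aeval_blockWitness_of_mem`,
  `X_mul_C_add_C_ne_zero`);
* vzG's `h = g f_{n-2,n} − f_{n-1,n} per x(n-2,n|J) − f_{nn} per x(n-2,n-1|J)` (here transposed:
  `vzgH`) lies in `P`, and its expansion (`vzgH_eq_rhs`, the display on p. 92 with the
  coefficient `−2 per x(n-2,n-1|J) per x(n-2,n|J)` of `x_{n-2,n-1}`) avoids the block, so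
  `h ∈ Q_B`; it is a nonzero polynomial because at a semi-generic point it evaluates to
  `−2 G₁ G₂` with `G₁, G₂` square subpermanents of the generic matrix (`subperm_X_ne_zero`) and
  `char K ≠ 2`.  Hence `⊥ < Q_B` and `height P ≥ 5` (`five_le_height_of_block`).

Algebraic closedness of `K` is not used (any field with `2 ≠ 0`).

* `subperm_map`, `subperm_congr_entries`, `subperm_insert_row`, `subperm_singleton`,
  `subperm_eq_one_of_pattern`, `aeval_subperm_X`, `subperm_X_ne_zero` — small additions to the
  subpermanent toolkit `Literature/LinearAlgebra/Matrix/PermanentSubperm.lean` (kept here, in the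
  `VonZurGathen` namespace, to leave that Mathlib-only file untouched);
* `pderiv_perPoly` — `∂ per/∂x_{rc}` is the subpermanent deleting row `r` and column `c`;
* `chainPt`, `chainIdeal`, `height_chainIdeal_insert`, `card_le_height_ker_aeval` — the chains;
* `vzgH`, `vzgHrhs`, `vzgH_eq_rhs` — the `h`-identity for an arbitrary square matrix;
* `five_le_height_of_block`, `five_le_height_of_vanishing`,
  `vonzurGathen1987_singPerm_height_holds`.

## References

* J. von zur Gathen, *Permanent and determinant*, Linear Algebra Appl. 96 (1987) 87–100,
  doi:10.1016/0024-3795(87)90337-5: §2, Lemma 2.3 and its proof (p. 91–92).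
* H. Minc, *Permanents*, Encyclopedia Math. Appl. 6, Addison-Wesley 1978, §1.2 (row expansion).
-/

noncomputable section

open Matrix MvPolynomial Finset

namespace Literature.Computability.AlgebraicComplexity

namespace VonZurGathen

/-! ### Subpermanent toolkit (complements `Literature/LinearAlgebra/Matrix/PermanentSubperm`) -/

section SubpermTools

variable {ι : Type*} [Fintype ι] [DecidableEq ι] {R S : Type*} [CommRing R] [CommRing S]

/-- Naturality of subpermanents under ring homomorphisms. [folklore] -/
theorem subperm_map (f : R →+* S) (M : Matrix ι ι R) (p q : ι → Prop) [DecidablePred p]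
    [DecidablePred q] : (M.map f).subperm p q = f (M.subperm p q) := by
  unfold Matrix.subperm
  rw [map_sum]
  refine Finset.sum_congr rfl fun g _ => ?_
  rw [map_prod]
  rfl

/-- A subpermanent only depends on the entries in the kept rows and columns. [folklore] -/
theorem subperm_congr_entries {M N : Matrix ι ι R} {p q : ι → Prop} [DecidablePred p]
    [DecidablePred q] (h : ∀ r c, q r → p c → M r c = N r c) :
    M.subperm p q = N.subperm p q := by
  unfold Matrix.subperm
  refine Finset.sum_congr rfl fun g _ => Finset.prod_congr rfl fun i _ => ?_
  exact h _ _ (g i).2 i.2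

/-- Expansion of the subpermanent on the rows `insert x Rw` (`x ∉ Rw`) and the columns `Cl` along
the row `x`: `per[insert x Rw | Cl] = Σ_{c ∈ Cl} M x c · per[Rw | Cl ∖ c]` (Minc 1978, §1.2;
a repackaging of `Matrix.subperm_expand_row`). [folklore] -/
theorem subperm_insert_row (M : Matrix ι ι R) {Rw : Finset ι} {x : ι} (hx : x ∉ Rw)
    (Cl : Finset ι) :
    M.subperm (· ∈ Cl) (· ∈ insert x Rw) =
      ∑ c ∈ Cl, M x c * M.subperm (· ∈ Cl.erase c) (· ∈ Rw) := by
  rw [M.subperm_expand_row (p := (· ∈ Cl)) (q := (· ∈ insert x Rw)) x (Finset.mem_insert_self _ _),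
    Finset.filter_mem_eq_inter, Finset.univ_inter]
  refine Finset.sum_congr rfl fun c _ => ?_
  congr 1
  exact M.subperm_congr (fun i => by simp [Finset.mem_erase, and_comm])
    (fun j => by
      simp only [Finset.mem_insert]
      constructor
      · rintro ⟨h | h, hne⟩
        · exact absurd h hne
        · exact h
      · intro h
        exact ⟨Or.inr h, fun h' => hx (h' ▸ h)⟩)

/-- A `1 × 1` subpermanent is the entry. [folklore] -/
theorem subperm_singleton (M : Matrix ι ι R) (r c : ι) :
    M.subperm (· ∈ ({c} : Finset ι)) (· ∈ ({r} : Finset ι)) = M r c := by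
  rw [M.subperm_congr (p' := (· ∈ ({c} : Finset ι))) (q' := (· ∈ insert r (∅ : Finset ι)))
      (fun _ => Iff.rfl) (fun j => by simp),
    subperm_insert_row M (Finset.notMem_empty r), Finset.sum_singleton, Finset.erase_singleton,
    M.subperm_of_isEmpty (fun i => Finset.notMem_empty i) (fun j => Finset.notMem_empty j), mul_one]

/-- A subpermanent supported on a permutation pattern equals `1`. [folklore] -/
theorem subperm_eq_one_of_pattern (M : Matrix ι ι R) {p q : ι → Prop} [DecidablePred p]
    [DecidablePred q] (e : {i // p i} ≃ {j // q j}) (h1 : ∀ i, M (e i) i = 1)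
    (h0 : ∀ (i : {i // p i}) (j : {j // q j}), j ≠ e i → M j i = 0) : M.subperm p q = 1 := by
  unfold Matrix.subperm
  rw [Finset.sum_eq_single e]
  · simp [h1]
  · intro f _ hf
    obtain ⟨i, hi⟩ : ∃ i, f i ≠ e i := by
      by_contra hall
      push Not at hall
      exact hf (Equiv.ext hall)
    exact Finset.prod_eq_zero (Finset.mem_univ i) (h0 i (f i) hi)
  · intro h
    exact absurd (Finset.mem_univ e) h

/-- A subset of size `card ι - 1` is the complement of a point. [folklore] -/
theorem exists_eq_univ_erase_of_card {s : Finset ι} (h : s.card + 1 = Fintype.card ι) :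
    ∃ x, s = Finset.univ.erase x := by
  have hc : sᶜ.card = 1 := by rw [Finset.card_compl]; omega
  obtain ⟨x, hx⟩ := Finset.card_eq_one.1 hc
  refine ⟨x, ?_⟩
  ext y
  simp only [Finset.mem_erase, Finset.mem_univ, and_true]
  have h1 : y ∈ sᶜ ↔ y = x := by rw [hx, Finset.mem_singleton]
  rw [Finset.mem_compl] at h1
  tauto

variable {K : Type*} [CommRing K]

/-- Evaluating a subpermanent of the generic matrix at a point `v` (in any `K`-algebra) gives the
subpermanent of the matrix `(v (r, c))`. [folklore] -/
theorem aeval_subperm_X {A : Type*} [CommRing A] [Algebra K A] (v : ι × ι → A) (p q : ι → Prop)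
    [DecidablePred p] [DecidablePred q] :
    aeval v ((mvPolynomialX ι ι K).subperm p q) = (Matrix.of fun r c => v (r, c)).subperm p q := by
  simp only [Matrix.subperm, map_sum, map_prod, Matrix.mvPolynomialX_apply, aeval_X,
    Matrix.of_apply]

/-- A square subpermanent of the generic matrix is a nonzero polynomial (evaluate at a
permutation pattern). [folklore] -/
theorem subperm_X_ne_zero [Nontrivial K] {Rw Cl : Finset ι} (h : Cl.card = Rw.card) :
    (mvPolynomialX ι ι K).subperm (· ∈ Cl) (· ∈ Rw) ≠ 0 := by
  have hcard : Fintype.card {i // i ∈ Cl} = Fintype.card {j // j ∈ Rw} := by simp [h]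
  let e : {i // i ∈ Cl} ≃ {j // j ∈ Rw} := Fintype.equivOfCardEq hcard
  let v : ι × ι → K := fun rc =>
    if hc : rc.2 ∈ Cl then (if ((e ⟨rc.2, hc⟩ : {j // j ∈ Rw}) : ι) = rc.1 then 1 else 0) else 0
  intro h0
  have h1 : aeval v ((mvPolynomialX ι ι K).subperm (· ∈ Cl) (· ∈ Rw)) = 1 := by
    rw [aeval_subperm_X]
    refine subperm_eq_one_of_pattern _ e (fun i => ?_) (fun i j hj => ?_)
    · simp [v, i.2]
    · have hne : ((e ⟨i, i.2⟩ : {j // j ∈ Rw}) : ι) ≠ j := fun h' =>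
        hj (Subtype.ext (by simpa using h'.symm))
      simp [v, i.2, hne]
  rw [h0, map_zero] at h1
  exact zero_ne_one h1

/-- A partial derivative `∂/∂x_{rc}` kills every subpermanent of the generic matrix not using the
row `r`. [folklore] -/
theorem pderiv_subperm_X_eq_zero (p q : ι → Prop) [DecidablePred p] [DecidablePred q] {r c : ι}
    (hr : ¬ q r) : pderiv (r, c) ((mvPolynomialX ι ι K).subperm p q) = 0 := by
  unfold Matrix.subperm
  rw [map_sum]
  refine Finset.sum_eq_zero fun f _ => ?_
  rw [derivation_prod]
  refine Finset.sum_eq_zero fun i _ => ?_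
  rw [Matrix.mvPolynomialX_apply, pderiv_X_of_ne, mul_zero]
  intro h
  exact hr ((Prod.mk.inj h).1 ▸ (f i).2)

/-- **`∂ per / ∂ x_{rc} = per x(r|c)`**: the partial derivative of the generic permanent with
respect to `x_{rc}` is the subpermanent with row `r` and column `c` deleted (vzG87 §2,
"and similarly for per"). [cite: Vonzurgathen1987, §2] -/
theorem pderiv_perPoly (r c : ι) :
    pderiv (r, c) (perPoly ι K) = (mvPolynomialX ι ι K).subperm (· ≠ c) (· ≠ r) := by
  have hper : perPoly ι K = (mvPolynomialX ι ι K).subperm (· ∈ (univ : Finset ι))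
      (· ∈ insert r (univ.erase r)) := by
    rw [perPoly, ← Matrix.subperm_true]
    exact (mvPolynomialX ι ι K).subperm_congr (fun i => by simp)
      (fun j => by simp [Finset.insert_erase])
  have hterm : ∀ c', pderiv (r, c) ((mvPolynomialX ι ι K) r c' *
      (mvPolynomialX ι ι K).subperm (· ∈ univ.erase c') (· ∈ univ.erase r)) =
      if c' = c then (mvPolynomialX ι ι K).subperm (· ∈ univ.erase c') (· ∈ univ.erase r)
      else 0 := by
    intro c'
    rw [Derivation.leibniz, pderiv_subperm_X_eq_zero _ _ (by simp), smul_zero, zero_add,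
      smul_eq_mul, Matrix.mvPolynomialX_apply, pderiv_X]
    by_cases h : c' = c
    · subst h
      simp
    · have hne : (r, c') ≠ (r, c) := fun e => h (Prod.mk.inj e).2
      simp [hne, h]
  rw [hper, subperm_insert_row _ (Finset.notMem_erase r _) univ, map_sum,
    Finset.sum_congr rfl fun c' _ => hterm c', Finset.sum_ite_eq' univ c,
    if_pos (Finset.mem_univ c)]
  exact (mvPolynomialX ι ι K).subperm_congr (fun i => by simp) (fun j => by simp)

end SubpermTools

/-! ### Chains of kernels: a lower bound for heights of kernels of evaluation maps -/

section Kernels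

variable {A D D' F F' : Type*} [CommRing A] [CommRing D] [IsDomain D] [CommRing D'] [IsDomain D']
  [FunLike F A D] [RingHomClass F A D] [FunLike F' A D'] [RingHomClass F' A D']

/-- One strict step between kernels of maps to domains raises the height by one: if
`ker φ ≤ ker ψ` and `ψ r = 0 ≠ φ r` then `height (ker φ) + 1 ≤ height (ker ψ)`. [folklore] -/
theorem height_ker_add_one_le (φ : F) (ψ : F') (hle : RingHom.ker φ ≤ RingHom.ker ψ) (r : A)
    (hr : ψ r = 0) (hr' : φ r ≠ 0) : (RingHom.ker φ).height + 1 ≤ (RingHom.ker ψ).height := by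
  haveI := RingHom.ker_isPrime φ
  haveI := RingHom.ker_isPrime ψ
  refine Ideal.height_add_one_le_of_lt_of_isPrime (lt_of_le_of_ne hle fun heq => hr' ?_)
  have hmem : r ∈ RingHom.ker ψ := hr
  rw [← heq] at hmem
  exact hmem

omit [CommRing D'] [IsDomain D'] [FunLike F' A D'] [RingHomClass F' A D'] in
/-- A nonzero element in the kernel of a map from a domain to a domain gives height `≥ 1`.
[folklore] -/
theorem one_le_height_ker [IsDomain A] (φ : F) (h : A) (h0 : h ≠ 0) (h1 : φ h = 0) :
    1 ≤ (RingHom.ker φ).height := by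
  haveI := RingHom.ker_isPrime φ
  have hlt : (⊥ : Ideal A) < RingHom.ker φ :=
    bot_lt_iff_ne_bot.2 fun heq => h0 (by
      have hmem : h ∈ RingHom.ker φ := h1
      rw [heq] at hmem
      exact (Submodule.mem_bot _).1 hmem)
  have h2 := Ideal.height_add_one_le_of_lt_of_isPrime hlt
  rwa [Ideal.height_bot, zero_add] at h2

/-- Counting step in `ℕ∞`. [folklore] -/
theorem natCast_succ_le {x y : ℕ∞} {n : ℕ} (h : (n : ℕ∞) ≤ x) (h' : x + 1 ≤ y) :
    ((n + 1 : ℕ) : ℕ∞) ≤ y := by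
  rw [Nat.cast_succ]
  exact (add_le_add h le_rfl).trans h'

end Kernels

section Chain

variable {K : Type*} [CommRing K] {σ : Type*} [DecidableEq σ] {L : Type*} [CommRing L]
  [Algebra K L]

/-!
The points `a^T := T.piecewise X (C ∘ a) : σ → L[X_σ]` (the coordinates in `T` freed to
indeterminates, the others kept at their value `a x`) and the primes
`Q_T := ker (f ↦ f(a^T)) ⊆ K[X_σ]`.
-/

/-- `T ⊆ T' ⇒ Q_{T'} ≤ Q_T` (`a^T` is a specialisation of `a^{T'}`). [folklore] -/
theorem ker_aeval_piecewise_anti (a : σ → L) {T T' : Finset σ} (h : T ⊆ T') :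
    RingHom.ker (aeval (R := K) (T'.piecewise X (C ∘ a) : σ → MvPolynomial σ L)) ≤
      RingHom.ker (aeval (R := K) (T.piecewise X (C ∘ a) : σ → MvPolynomial σ L)) := by
  intro f hf
  rw [RingHom.mem_ker] at hf ⊢
  let s : MvPolynomial σ L →ₐ[K] MvPolynomial σ L :=
    (aeval (R := L) (T.piecewise X (C ∘ a) : σ → MvPolynomial σ L)).restrictScalars K
  have hs : s.comp (aeval (T'.piecewise X (C ∘ a) : σ → MvPolynomial σ L)) =
      aeval (T.piecewise X (C ∘ a) : σ → MvPolynomial σ L) := by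
    rw [comp_aeval]
    congr 1
    funext x
    simp only [s, AlgHom.coe_restrictScalars']
    by_cases hx' : x ∈ T'
    · rw [Finset.piecewise_eq_of_mem (hi := hx'), aeval_X]
    · have hx : x ∉ T := fun hx => hx' (h hx)
      rw [Finset.piecewise_eq_of_notMem (hi := hx'), Finset.piecewise_eq_of_notMem (hi := hx),
        Function.comp_apply, aeval_C, MvPolynomial.algebraMap_eq]
  rw [← hs, AlgHom.comp_apply, hf, map_zero]

/-- `Q_∅ = ker (f ↦ f(a))`. [folklore] -/
theorem ker_aeval_piecewise_empty (a : σ → L) :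
    RingHom.ker (aeval (R := K) ((∅ : Finset σ).piecewise X (C ∘ a) : σ → MvPolynomial σ L)) =
      RingHom.ker (aeval (R := K) a) := by
  ext f
  rw [RingHom.mem_ker, RingHom.mem_ker, Finset.piecewise_empty, aeval_C_comp_left, C_eq_zero]

variable [IsDomain L]

/-- **Height step**: a witness `r` with `r(a^T) = 0 ≠ r(a^{T ∪ {x}})` gives
`height Q_{T ∪ {x}} + 1 ≤ height Q_T`. [folklore] -/
theorem height_ker_aeval_piecewise_insert (a : σ → L) (T : Finset σ) (x : σ)
    (r : MvPolynomial σ K) (h0 : aeval (T.piecewise X (C ∘ a) : σ → MvPolynomial σ L) r = 0)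
    (h1 : aeval ((insert x T).piecewise X (C ∘ a) : σ → MvPolynomial σ L) r ≠ 0) :
    (RingHom.ker (aeval (R := K)
        ((insert x T).piecewise X (C ∘ a) : σ → MvPolynomial σ L))).height + 1 ≤
      (RingHom.ker (aeval (R := K) (T.piecewise X (C ∘ a) : σ → MvPolynomial σ L))).height :=
  height_ker_add_one_le _ _ (ker_aeval_piecewise_anti a (Finset.subset_insert x T)) r h0 h1

omit [DecidableEq σ] [IsDomain L] in
/-- The linear witness `X_x · C u + C w` (`u ≠ 0`) is nonzero. [folklore] -/
theorem X_mul_C_add_C_ne_zero {x : σ} {u w : L} (hu : u ≠ 0) :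
    (X x * C u + C w : MvPolynomial σ L) ≠ 0 := by
  intro h
  have h0 := congrArg (MvPolynomial.eval (fun _ => (0 : L))) h
  have h1 := congrArg (MvPolynomial.eval (fun _ => (1 : L))) h
  simp only [map_add, map_mul, eval_X, eval_C, zero_mul, zero_add, one_mul, map_zero] at h0 h1
  rw [h0, add_zero] at h1
  exact hu h1

/-- **Coordinates vanishing at `a` contribute to the height**: if `a` vanishes on `T` then
`height Q_T + |T| ≤ height Q_∅` (free the coordinates of `T` one at a time; the witness for
`x` is `X_x`). [folklore] -/
theorem height_ker_aeval_piecewise_add_card_le (a : σ → L) (T : Finset σ)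
    (hT : ∀ x ∈ T, a x = 0) :
    (RingHom.ker (aeval (R := K) (T.piecewise X (C ∘ a) : σ → MvPolynomial σ L))).height +
        T.card ≤
      (RingHom.ker (aeval (R := K)
        ((∅ : Finset σ).piecewise X (C ∘ a) : σ → MvPolynomial σ L))).height := by
  induction T using Finset.induction_on with
  | empty => simp
  | insert x T hx ih =>
    have hstep := height_ker_aeval_piecewise_insert (K := K) a T x (X x)
      (by rw [aeval_X, Finset.piecewise_eq_of_notMem (hi := hx), Function.comp_apply,
        hT x (Finset.mem_insert_self _ _), map_zero])
      (by rw [aeval_X, Finset.piecewise_eq_of_mem (hi := Finset.mem_insert_self x T)]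
          exact X_ne_zero _)
    have ih' := ih fun y hy => hT y (Finset.mem_insert_of_mem hy)
    rw [Finset.card_insert_of_notMem hx, Nat.cast_succ, add_comm (T.card : ℕ∞) 1, ← add_assoc]
    exact (add_le_add hstep le_rfl).trans ih'

/-- Hence `|T| ≤ height (ker (f ↦ f(a)))` for any finite set `T` of coordinates vanishing at
`a`. [folklore] -/
theorem card_le_height_ker_aeval (a : σ → L) (T : Finset σ) (hT : ∀ x ∈ T, a x = 0) :
    (T.card : ℕ∞) ≤ (RingHom.ker (aeval (R := K) a)).height := by
  rw [← ker_aeval_piecewise_empty]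
  exact le_add_self.trans (height_ker_aeval_piecewise_add_card_le a T hT)

end Chain

/-! ### The identity behind von zur Gathen's polynomial `h` (Lemma 2.3, p. 92) -/

section HIdentity

variable {ι : Type*} [Fintype ι] [DecidableEq ι] {R : Type*} [CommRing R]

/-- **The `h`-identity** (vzG87 p. 92).  von zur Gathen's
`h = g·f_{n-2,n} − f_{n-1,n}·per x(n-2,n|J) − f_{nn}·per x(n-2,n-1|J)`, for an arbitrary square
matrix `N`, in transposed and relabelled form: rows `Rw ∪ {i}` (`i` the extra row), columns
`S' ∪ {j₁, j₂, j₃}`; with `g = per[Rw | S'∪j₃]`, `F₃ = per[Rw∪i | S'∪j₁j₂]`,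
`F₂ = per[Rw∪i | S'∪j₃j₁]`, `F₁ = per[Rw∪i | S'∪j₃j₂]`, `G₁ = per[Rw | S'∪j₂]`,
`G₂ = per[Rw | S'∪j₁]` the left-hand side is `h = g F₃ − F₂ G₁ − F₁ G₂`; expanding `F₃, F₂, F₁`
along the row `i`, the terms through `N i j₁`, `N i j₂` cancel and
`h = −2 N_{i j₃} G₁ G₂ + Σ_{c ∈ S'} N_{ic}(⋯)` (the display after "Consider" on p. 92, whose
`x_{n-2,n-1}`-coefficient is `−2 per x(n-2,n-1|J) per x(n-2,n|J)`): only the entries of the row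
`i` in the columns `S' ∪ {j₃}` and the rows `Rw` occur on the right.
[cite: Vonzurgathen1987, proof of Lemma 2.3] -/
theorem vzgH_eq_rhs (N : Matrix ι ι R) {Rw S' : Finset ι} {i j₁ j₂ j₃ : ι} (hi : i ∉ Rw)
    (h₁₂ : j₁ ≠ j₂) (h₁₃ : j₁ ≠ j₃) (h₂₃ : j₂ ≠ j₃) (hj₁ : j₁ ∉ S') (hj₂ : j₂ ∉ S')
    (hj₃ : j₃ ∉ S') :
    N.subperm (· ∈ insert j₃ S') (· ∈ Rw) *
          N.subperm (· ∈ insert j₁ (insert j₂ S')) (· ∈ insert i Rw) -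
        N.subperm (· ∈ insert j₃ (insert j₁ S')) (· ∈ insert i Rw) *
          N.subperm (· ∈ insert j₂ S') (· ∈ Rw) -
      N.subperm (· ∈ insert j₃ (insert j₂ S')) (· ∈ insert i Rw) *
        N.subperm (· ∈ insert j₁ S') (· ∈ Rw) =
    -(2 * N i j₃ * N.subperm (· ∈ insert j₂ S') (· ∈ Rw) * N.subperm (· ∈ insert j₁ S') (· ∈ Rw)) +
      N.subperm (· ∈ insert j₃ S') (· ∈ Rw) *
        (∑ c ∈ S', N i c * N.subperm (· ∈ (insert j₁ (insert j₂ S')).erase c) (· ∈ Rw)) -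
      N.subperm (· ∈ insert j₂ S') (· ∈ Rw) *
        (∑ c ∈ S', N i c * N.subperm (· ∈ (insert j₃ (insert j₁ S')).erase c) (· ∈ Rw)) -
      N.subperm (· ∈ insert j₁ S') (· ∈ Rw) *
        (∑ c ∈ S', N i c * N.subperm (· ∈ (insert j₃ (insert j₂ S')).erase c) (· ∈ Rw)) := by
  have hF₃ : N.subperm (· ∈ insert j₁ (insert j₂ S')) (· ∈ insert i Rw) =
      N i j₁ * N.subperm (· ∈ insert j₂ S') (· ∈ Rw) +
        (N i j₂ * N.subperm (· ∈ insert j₁ S') (· ∈ Rw) +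
        ∑ c ∈ S', N i c * N.subperm (· ∈ (insert j₁ (insert j₂ S')).erase c) (· ∈ Rw)) := by
    rw [subperm_insert_row N hi (insert j₁ (insert j₂ S')),
      Finset.sum_insert (show j₁ ∉ insert j₂ S' by simp [h₁₂, hj₁]), Finset.sum_insert hj₂,
      Finset.erase_insert (show j₁ ∉ insert j₂ S' by simp [h₁₂, hj₁]),
      Finset.erase_insert_of_ne h₁₂, Finset.erase_insert hj₂]
  have hF₂ : N.subperm (· ∈ insert j₃ (insert j₁ S')) (· ∈ insert i Rw) =
      N i j₃ * N.subperm (· ∈ insert j₁ S') (· ∈ Rw) +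
        (N i j₁ * N.subperm (· ∈ insert j₃ S') (· ∈ Rw) +
        ∑ c ∈ S', N i c * N.subperm (· ∈ (insert j₃ (insert j₁ S')).erase c) (· ∈ Rw)) := by
    rw [subperm_insert_row N hi (insert j₃ (insert j₁ S')),
      Finset.sum_insert (show j₃ ∉ insert j₁ S' by simp [Ne.symm h₁₃, hj₃]), Finset.sum_insert hj₁,
      Finset.erase_insert (show j₃ ∉ insert j₁ S' by simp [Ne.symm h₁₃, hj₃]),
      Finset.erase_insert_of_ne (Ne.symm h₁₃), Finset.erase_insert hj₁]
  have hF₁ : N.subperm (· ∈ insert j₃ (insert j₂ S')) (· ∈ insert i Rw) =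
      N i j₃ * N.subperm (· ∈ insert j₂ S') (· ∈ Rw) +
        (N i j₂ * N.subperm (· ∈ insert j₃ S') (· ∈ Rw) +
        ∑ c ∈ S', N i c * N.subperm (· ∈ (insert j₃ (insert j₂ S')).erase c) (· ∈ Rw)) := by
    rw [subperm_insert_row N hi (insert j₃ (insert j₂ S')),
      Finset.sum_insert (show j₃ ∉ insert j₂ S' by simp [Ne.symm h₂₃, hj₃]), Finset.sum_insert hj₂,
      Finset.erase_insert (show j₃ ∉ insert j₂ S' by simp [Ne.symm h₂₃, hj₃]),
      Finset.erase_insert_of_ne (Ne.symm h₂₃), Finset.erase_insert hj₂]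
  rw [hF₃, hF₂, hF₁]
  ring

/-- The expanded form of `h` only sees the row `i` on the columns `S' ∪ {j₃}` and the rows `Rw`.
[cite: Vonzurgathen1987, proof of Lemma 2.3] -/
theorem vzgHrhs_congr {N N' : Matrix ι ι R} {Rw S' : Finset ι} {i j₁ j₂ j₃ : ι}
    (hrow : ∀ c ∈ insert j₃ S', N i c = N' i c) (hRw : ∀ r ∈ Rw, ∀ c, N r c = N' r c) :
    -(2 * N i j₃ * N.subperm (· ∈ insert j₂ S') (· ∈ Rw) * N.subperm (· ∈ insert j₁ S') (· ∈ Rw)) +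
      N.subperm (· ∈ insert j₃ S') (· ∈ Rw) *
        (∑ c ∈ S', N i c * N.subperm (· ∈ (insert j₁ (insert j₂ S')).erase c) (· ∈ Rw)) -
      N.subperm (· ∈ insert j₂ S') (· ∈ Rw) *
        (∑ c ∈ S', N i c * N.subperm (· ∈ (insert j₃ (insert j₁ S')).erase c) (· ∈ Rw)) -
      N.subperm (· ∈ insert j₁ S') (· ∈ Rw) *
        (∑ c ∈ S', N i c * N.subperm (· ∈ (insert j₃ (insert j₂ S')).erase c) (· ∈ Rw)) =
    -(2 * N' i j₃ * N'.subperm (· ∈ insert j₂ S') (· ∈ Rw) *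
        N'.subperm (· ∈ insert j₁ S') (· ∈ Rw)) +
      N'.subperm (· ∈ insert j₃ S') (· ∈ Rw) *
        (∑ c ∈ S', N' i c * N'.subperm (· ∈ (insert j₁ (insert j₂ S')).erase c) (· ∈ Rw)) -
      N'.subperm (· ∈ insert j₂ S') (· ∈ Rw) *
        (∑ c ∈ S', N' i c * N'.subperm (· ∈ (insert j₃ (insert j₁ S')).erase c) (· ∈ Rw)) -
      N'.subperm (· ∈ insert j₁ S') (· ∈ Rw) *
        (∑ c ∈ S', N' i c * N'.subperm (· ∈ (insert j₃ (insert j₂ S')).erase c) (· ∈ Rw)) := by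
  have hsub : ∀ (p : ι → Prop) [DecidablePred p], N.subperm p (· ∈ Rw) = N'.subperm p (· ∈ Rw) :=
    fun p _ => subperm_congr_entries fun r c hr _ => hRw r hr c
  have hi₃ : N i j₃ = N' i j₃ := hrow j₃ (Finset.mem_insert_self _ _)
  have hsum : ∀ Cl : Finset ι, ∑ c ∈ S', N i c * N.subperm (· ∈ Cl.erase c) (· ∈ Rw) =
      ∑ c ∈ S', N' i c * N'.subperm (· ∈ Cl.erase c) (· ∈ Rw) := fun Cl =>
    Finset.sum_congr rfl fun c hc => by rw [hrow c (Finset.mem_insert_of_mem hc), hsub]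
  rw [hsub, hsub, hsub, hi₃, hsum, hsum, hsum]

end HIdentity

/-! ### The main case: a block of four freed coordinates and the polynomial `h` -/

section Block

variable {ι : Type*} [Fintype ι] [DecidableEq ι] {K : Type*} [Field K] {L : Type*} [CommRing L]
  [Algebra K L]

omit [Fintype ι] in
/-- Inside the block `{i₁, i₂} × {j₁, j₂}` (rows off `Rw`, columns off `Cl`), the only position
meeting the rows `Rw ∪ {i'}` and the columns `Cl ∪ {j'}` is `(i', j')`. [folklore] -/
theorem blockOK {Rw Cl : Finset ι} {i₁ i₂ j₁ j₂ : ι} (hi₁ : i₁ ∉ Rw) (hi₂ : i₂ ∉ Rw)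
    (hj₁ : j₁ ∉ Cl) (hj₂ : j₂ ∉ Cl) {T : Finset (ι × ι)}
    (hT : ∀ r c, (r, c) ∈ T → (r = i₁ ∨ r = i₂) ∧ (c = j₁ ∨ c = j₂)) (i' j' : ι) :
    ∀ x ∈ T, x.1 ∈ insert i' Rw → x.2 ∈ insert j' Cl → x = (i', j') := by
  rintro ⟨r, c⟩ hx hr hc
  obtain ⟨hr', hc'⟩ := hT r c hx
  simp only [Finset.mem_insert] at hr hc
  have hr'' : r = i' := by
    rcases hr with h | h
    · exact h
    · rcases hr' with rfl | rfl
      · exact absurd h hi₁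
      · exact absurd h hi₂
  have hc'' : c = j' := by
    rcases hc with h | h
    · exact h
    · rcases hc' with rfl | rfl
      · exact absurd h hj₁
      · exact absurd h hj₂
  rw [hr'', hc'']

/-- **Outer dependence**: a subpermanent avoiding the freed positions `T` takes the same value
at `a^T = T.piecewise X (C ∘ a)` as at `a` (up to the constant embedding `C`). [folklore] -/
theorem subperm_piecewise_eq_C (a : ι × ι → L) (T : Finset (ι × ι)) {p q : ι → Prop}
    [DecidablePred p] [DecidablePred q] (hT : ∀ r c, q r → p c → (r, c) ∉ T) :
    (Matrix.of fun r c => (T.piecewise X (C ∘ a) : ι × ι → MvPolynomial (ι × ι) L) (r, c)).subperm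
        p q = C ((Matrix.of fun r c => a (r, c)).subperm p q) := by
  rw [← subperm_map (C : L →+* MvPolynomial (ι × ι) L)]
  refine subperm_congr_entries fun r c hq hp => ?_
  simp [Finset.piecewise, hT r c hq hp]

/-- The witness for freeing the block entry `(i', j')` — the subpermanent of the generic matrix
on the rows `Rw ∪ {i'}` and the columns `Cl ∪ {j'}` (one of vzG's four partials
`f_{nn}, f_{n-1,n-1}, f_{n-1,n}, f_{n,n-1}`, p. 92) — takes at `a^T` the value it has at `a`
(up to `C`) as long as `(i', j')` is not freed. [cite: Vonzurgathen1987, proof of Lemma 2.3] -/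
theorem aeval_blockWitness_of_notMem (a : ι × ι → L) {Rw Cl : Finset ι} {i' j' : ι}
    {T : Finset (ι × ι)} (hT : ∀ x ∈ T, x.1 ∈ insert i' Rw → x.2 ∈ insert j' Cl → False) :
    aeval (T.piecewise X (C ∘ a) : ι × ι → MvPolynomial (ι × ι) L)
        ((mvPolynomialX ι ι K).subperm (· ∈ insert j' Cl) (· ∈ insert i' Rw)) =
      C ((Matrix.of fun r c => a (r, c)).subperm (· ∈ insert j' Cl) (· ∈ insert i' Rw)) := by
  rw [aeval_subperm_X]
  exact subperm_piecewise_eq_C a T fun r c hr hc hmem => hT _ hmem hr hc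

/-- **vzG's rational expression of a block coordinate** (p. 92: "developing `f_{nn}` along the
`(n-1)`st column gives `0 = Σ_i x_{i,n-1} per x(i,n|n-1,n) + x_{n-1,n-1} g`"): once `(i', j')`
is freed, the witness evaluates to `X_{i'j'} · g(a) + (constant)`.
[cite: Vonzurgathen1987, proof of Lemma 2.3] -/
theorem aeval_blockWitness_of_mem (a : ι × ι → L) {Rw Cl : Finset ι} {i' j' : ι} (hi' : i' ∉ Rw)
    (hj' : j' ∉ Cl) {T : Finset (ι × ι)}
    (hT : ∀ x ∈ T, x.1 ∈ insert i' Rw → x.2 ∈ insert j' Cl → x = (i', j')) (hmem : (i', j') ∈ T) :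
    aeval (T.piecewise X (C ∘ a) : ι × ι → MvPolynomial (ι × ι) L)
        ((mvPolynomialX ι ι K).subperm (· ∈ insert j' Cl) (· ∈ insert i' Rw)) =
      X (i', j') * C ((Matrix.of fun r c => a (r, c)).subperm (· ∈ Cl) (· ∈ Rw)) +
        C (∑ c ∈ Cl, a (i', c) *
          (Matrix.of fun r c => a (r, c)).subperm (· ∈ (insert j' Cl).erase c) (· ∈ Rw)) := by
  have hRw : ∀ (p : ι → Prop) [DecidablePred p], (∀ c, p c → c ∈ insert j' Cl) →
      (Matrix.of fun r c =>
          (T.piecewise X (C ∘ a) : ι × ι → MvPolynomial (ι × ι) L) (r, c)).subperm p (· ∈ Rw) =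
        C ((Matrix.of fun r c => a (r, c)).subperm p (· ∈ Rw)) := by
    intro p _ hp
    refine subperm_piecewise_eq_C a T fun r c hr hc hx => hi' ?_
    have h := hT _ hx (Finset.mem_insert_of_mem hr) (hp c hc)
    rw [Prod.mk.injEq] at h
    exact h.1 ▸ hr
  rw [aeval_subperm_X, subperm_insert_row _ hi' (insert j' Cl), Finset.sum_insert hj',
    Finset.erase_insert hj', map_sum]
  congr 1
  · rw [Matrix.of_apply, hRw _ (fun c hc => Finset.mem_insert_of_mem hc)]
    simp [Finset.piecewise, hmem]
  · refine Finset.sum_congr rfl fun c hc => ?_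
    rw [map_mul, hRw _ (fun c' hc' => Finset.mem_of_mem_erase hc'), Matrix.of_apply]
    congr 1
    have hc' : (i', c) ∉ T := fun hx => hj' (by
      have h := hT _ hx (Finset.mem_insert_self _ _) (Finset.mem_insert_of_mem hc)
      rw [Prod.mk.injEq] at h
      exact h.2 ▸ hc)
    simp [Finset.piecewise, hc']

variable [IsDomain L]

/-- **The main case of vzG's proof of Lemma 2.3** (p. 92), in height form and for a general
`k × k` block instead of `k = n - 2`: let `a` be a point over a domain `L ⊇ K`,
`g = per[Rw | Cl](a) ≠ 0` with `|Rw| = |Cl| = k`, all `(k+1) × (k+1)` subpermanents of `a`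
vanishing, two spare rows `i₁ ≠ i₂ ∉ Rw`, two spare columns `j₁ ≠ j₂ ∉ Cl` and a third column
`j₃ ∈ Cl` (`Cl = S' ∪ {j₃}`).  Then `height (ker (f ↦ f(a))) ≥ 5`: freeing the four block
coordinates `{i₁,i₂} × {j₁,j₂}` one at a time gives a chain `Q_B < ⋯ < Q_∅ = ker` of length `4`
(the four partials are the witnesses, `g(a) ≠ 0`), and vzG's `h` is a nonzero polynomial in `Q_B`
(it lies in the ideal of the partials, its expanded form avoids the block, and at a semi-generic
point it evaluates to `−2 G₁ G₂ ≠ 0` since `char K ≠ 2`). [cite: Vonzurgathen1987, Lemma 2.3] -/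
theorem five_le_height_of_block (h2 : (2 : K) ≠ 0) (a : ι × ι → L) {Rw S' : Finset ι}
    {i₁ i₂ j₁ j₂ j₃ : ι} (hi : i₁ ≠ i₂) (hi₁ : i₁ ∉ Rw) (hi₂ : i₂ ∉ Rw)
    (h₁₂ : j₁ ≠ j₂) (h₁₃ : j₁ ≠ j₃) (h₂₃ : j₂ ≠ j₃) (hj₁ : j₁ ∉ S') (hj₂ : j₂ ∉ S')
    (hj₃ : j₃ ∉ S') (hcard : S'.card + 1 = Rw.card)
    (hg : (Matrix.of fun r c => a (r, c)).subperm (· ∈ insert j₃ S') (· ∈ Rw) ≠ 0)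
    (hvan : ∀ Rw' Cl' : Finset ι, Rw'.card = Rw.card + 1 → Cl'.card = Rw.card + 1 →
      (Matrix.of fun r c => a (r, c)).subperm (· ∈ Cl') (· ∈ Rw') = 0) :
    (5 : ℕ∞) ≤ (RingHom.ker (aeval (R := K) a)).height := by
  -- the points `a^T` and the kernels `Q_T`
  set pt : Finset (ι × ι) → ι × ι → MvPolynomial (ι × ι) L := fun T => T.piecewise X (C ∘ a)
    with hpt
  set Cl := insert j₃ S' with hCl
  have hj₁C : j₁ ∉ Cl := by simp [hCl, h₁₃, hj₁]
  have hj₂C : j₂ ∉ Cl := by simp [hCl, h₂₃, hj₂]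
  have hClcard : Cl.card = Rw.card := by rw [hCl, Finset.card_insert_of_notMem hj₃, hcard]
  have hRi : ∀ {i'}, i' ∉ Rw → (insert i' Rw).card = Rw.card + 1 := fun h =>
    Finset.card_insert_of_notMem h
  have hCj : ∀ {j'}, j' ∉ Cl → (insert j' Cl).card = Rw.card + 1 := fun h => by
    rw [Finset.card_insert_of_notMem h, hClcard]
  -- the chain of freed block entries
  set T₁ : Finset (ι × ι) := insert (i₁, j₁) ∅ with hT₁
  set T₂ : Finset (ι × ι) := insert (i₁, j₂) T₁ with hT₂
  set T₃ : Finset (ι × ι) := insert (i₂, j₁) T₂ with hT₃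
  set T₄ : Finset (ι × ι) := insert (i₂, j₂) T₃ with hT₄
  have hB : ∀ r c, (r, c) ∈ T₄ → (r = i₁ ∨ r = i₂) ∧ (c = j₁ ∨ c = j₂) := by
    intro r c hx
    simp only [hT₄, hT₃, hT₂, hT₁, Finset.mem_insert, Prod.mk.injEq, Finset.notMem_empty,
      or_false] at hx
    rcases hx with ⟨rfl, rfl⟩ | ⟨rfl, rfl⟩ | ⟨rfl, rfl⟩ | ⟨rfl, rfl⟩ <;> simp
  have hB₃ : ∀ r c, (r, c) ∈ T₃ → (r = i₁ ∨ r = i₂) ∧ (c = j₁ ∨ c = j₂) := fun r c hx =>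
    hB r c (Finset.mem_insert_of_mem hx)
  have hB₂ : ∀ r c, (r, c) ∈ T₂ → (r = i₁ ∨ r = i₂) ∧ (c = j₁ ∨ c = j₂) := fun r c hx =>
    hB₃ r c (Finset.mem_insert_of_mem hx)
  have hB₁ : ∀ r c, (r, c) ∈ T₁ → (r = i₁ ∨ r = i₂) ∧ (c = j₁ ∨ c = j₂) := fun r c hx =>
    hB₂ r c (Finset.mem_insert_of_mem hx)
  -- one step of the chain: free the block entry `(i', j')`
  have step : ∀ (T : Finset (ι × ι)) (i' j' : ι), i' ∉ Rw → j' ∉ Cl →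
      (∀ r c, (r, c) ∈ insert (i', j') T → (r = i₁ ∨ r = i₂) ∧ (c = j₁ ∨ c = j₂)) →
      (i', j') ∉ T →
      (RingHom.ker (aeval (R := K) (pt (insert (i', j') T)))).height + 1 ≤
        (RingHom.ker (aeval (R := K) (pt T))).height := by
    intro T i' j' hi' hj' hBT hnot
    refine height_ker_aeval_piecewise_insert a T (i', j')
      ((mvPolynomialX ι ι K).subperm (· ∈ insert j' Cl) (· ∈ insert i' Rw)) ?_ ?_
    · have hT' : ∀ x ∈ T, x.1 ∈ insert i' Rw → x.2 ∈ insert j' Cl → False :=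
        fun x hx hr hc => hnot (blockOK hi₁ hi₂ hj₁C hj₂C
          (fun r c h => hBT r c (Finset.mem_insert_of_mem h)) i' j' x hx hr hc ▸ hx)
      rw [aeval_blockWitness_of_notMem a hT', hvan _ _ (hRi hi') (hCj hj'), map_zero]
    · rw [aeval_blockWitness_of_mem a hi' hj' (blockOK hi₁ hi₂ hj₁C hj₂C hBT i' j')
        (Finset.mem_insert_self _ _)]
      exact X_mul_C_add_C_ne_zero hg
  have s₁ := step ∅ i₁ j₁ hi₁ hj₁C hB₁ (Finset.notMem_empty _)
  have s₂ := step T₁ i₁ j₂ hi₁ hj₂C hB₂ (by simp [hT₁, Ne.symm h₁₂])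
  have s₃ := step T₂ i₂ j₁ hi₂ hj₁C hB₃ (by simp [hT₂, hT₁, Ne.symm hi])
  have s₄ := step T₃ i₂ j₂ hi₂ hj₂C hB (by simp [hT₃, hT₂, hT₁, Ne.symm hi, Ne.symm h₁₂])
  -- the bottom of the chain: vzG's polynomial `h = g F₃ − F₂ G₁ − F₁ G₂`
  set X' := mvPolynomialX ι ι K with hX'
  set hP : MvPolynomial (ι × ι) K :=
    X'.subperm (· ∈ insert j₃ S') (· ∈ Rw) *
          X'.subperm (· ∈ insert j₁ (insert j₂ S')) (· ∈ insert i₂ Rw) -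
        X'.subperm (· ∈ insert j₃ (insert j₁ S')) (· ∈ insert i₂ Rw) *
          X'.subperm (· ∈ insert j₂ S') (· ∈ Rw) -
      X'.subperm (· ∈ insert j₃ (insert j₂ S')) (· ∈ insert i₂ Rw) *
        X'.subperm (· ∈ insert j₁ S') (· ∈ Rw) with hhP
  have hC₃ : (insert j₁ (insert j₂ S')).card = Rw.card + 1 := by
    rw [Finset.card_insert_of_notMem (by simp [h₁₂, hj₁]), Finset.card_insert_of_notMem hj₂,
      ← hcard]
  have hC₂ : (insert j₃ (insert j₁ S')).card = Rw.card + 1 := by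
    rw [Finset.card_insert_of_notMem (by simp [Ne.symm h₁₃, hj₃]), Finset.card_insert_of_notMem hj₁,
      ← hcard]
  have hC₁ : (insert j₃ (insert j₂ S')).card = Rw.card + 1 := by
    rw [Finset.card_insert_of_notMem (by simp [Ne.symm h₂₃, hj₃]), Finset.card_insert_of_notMem hj₂,
      ← hcard]
  -- `h(a) = 0`: the three bordered subpermanents are `(k+1) × (k+1)`
  set Ma := (Matrix.of fun r c => a (r, c)) with hMa
  have hva : Ma.subperm (· ∈ insert j₃ S') (· ∈ Rw) *
          Ma.subperm (· ∈ insert j₁ (insert j₂ S')) (· ∈ insert i₂ Rw) -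
        Ma.subperm (· ∈ insert j₃ (insert j₁ S')) (· ∈ insert i₂ Rw) *
          Ma.subperm (· ∈ insert j₂ S') (· ∈ Rw) -
      Ma.subperm (· ∈ insert j₃ (insert j₂ S')) (· ∈ insert i₂ Rw) *
        Ma.subperm (· ∈ insert j₁ S') (· ∈ Rw) = 0 := by
    rw [hvan _ _ (hRi hi₂) hC₃, hvan _ _ (hRi hi₂) hC₂, hvan _ _ (hRi hi₂) hC₁]
    ring
  -- `h(a^B) = 0`: the expanded form of `h` avoids the block
  have hzero : aeval (pt T₄) hP = 0 := by
    simp only [hhP, hpt, hX', map_sub, map_mul, aeval_subperm_X]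
    rw [vzgH_eq_rhs _ hi₂ h₁₂ h₁₃ h₂₃ hj₁ hj₂ hj₃,
      vzgHrhs_congr (N' := (Matrix.of fun r c => a (r, c)).map (C : L →+* MvPolynomial (ι × ι) L))
        ?_ ?_,
      ← vzgH_eq_rhs _ hi₂ h₁₂ h₁₃ h₂₃ hj₁ hj₂ hj₃]
    · simp only [subperm_map]
      rw [← map_mul, ← map_mul, ← map_mul, ← map_sub, ← map_sub, hva, map_zero]
    · intro c hc
      have hx : (i₂, c) ∉ T₄ := fun hx => by
        rcases (hB _ _ hx).2 with h | h
        · exact hj₁C (h ▸ hc)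
        · exact hj₂C (h ▸ hc)
      simp [Finset.piecewise, hx]
    · intro r hr c
      have hx : (r, c) ∉ T₄ := fun hx => by
        rcases (hB _ _ hx).1 with h | h
        · exact hi₁ (h ▸ hr)
        · exact hi₂ (h ▸ hr)
      simp [Finset.piecewise, hx]
  -- `h ≠ 0`: at the semi-generic point (generic on the rows `Rw`, `1` at `(i₂, j₃)`, else `0`)
  -- it evaluates to `−2 G₁ G₂ ≠ 0`
  have hne : hP ≠ 0 := by
    intro h0
    let v : ι × ι → MvPolynomial (ι × ι) K := fun rc =>
      if rc.1 ∈ Rw then X rc else if rc = (i₂, j₃) then 1 else 0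
    have hv := congrArg (aeval v) h0
    simp only [hhP, hX', map_sub, map_mul, aeval_subperm_X, map_zero] at hv
    rw [vzgH_eq_rhs _ hi₂ h₁₂ h₁₃ h₂₃ hj₁ hj₂ hj₃] at hv
    have hsub : ∀ (p : ι → Prop) [DecidablePred p],
        (Matrix.of fun r c => v (r, c)).subperm p (· ∈ Rw) =
          (mvPolynomialX ι ι K).subperm p (· ∈ Rw) :=
      fun p _ => subperm_congr_entries fun r c hr _ => by simp [v, hr, Matrix.mvPolynomialX_apply]
    have hrow0 : ∀ c ∈ S', (Matrix.of fun r c => v (r, c)) i₂ c = 0 := fun c hc => by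
      have hc3 : c ≠ j₃ := fun h => hj₃ (h ▸ hc)
      simp [v, hi₂, hc3]
    have hrow1 : (Matrix.of fun r c => v (r, c)) i₂ j₃ = 1 := by simp [v, hi₂]
    have hsum0 : ∀ Cl₀ : Finset ι, ∑ c ∈ S', (Matrix.of fun r c => v (r, c)) i₂ c *
        (Matrix.of fun r c => v (r, c)).subperm (· ∈ Cl₀.erase c) (· ∈ Rw) = 0 := fun Cl₀ =>
      Finset.sum_eq_zero fun c hc => by rw [hrow0 c hc, zero_mul]
    have hG₁ := subperm_X_ne_zero (K := K) (Rw := Rw) (Cl := insert j₂ S')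
      (by rw [Finset.card_insert_of_notMem hj₂, hcard])
    have hG₂ := subperm_X_ne_zero (K := K) (Rw := Rw) (Cl := insert j₁ S')
      (by rw [Finset.card_insert_of_notMem hj₁, hcard])
    have h2A : (2 : MvPolynomial (ι × ι) K) ≠ 0 := fun h => h2 (by
      apply MvPolynomial.C_injective (ι × ι) K
      rw [map_ofNat, h, map_zero])
    rw [hsub, hsub, hsub, hrow1, hsum0, hsum0, hsum0, mul_zero, mul_zero, mul_zero, add_zero,
      sub_zero, sub_zero, mul_one] at hv
    exact (neg_ne_zero.2 (mul_ne_zero (mul_ne_zero h2A hG₁) hG₂)) hv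
  have b₄ : ((1 : ℕ) : ℕ∞) ≤ (RingHom.ker (aeval (R := K) (pt T₄))).height := by
    rw [Nat.cast_one]
    exact one_le_height_ker _ hP hne hzero
  have b₀ := natCast_succ_le (natCast_succ_le (natCast_succ_le (natCast_succ_le b₄ s₄) s₃) s₂) s₁
  rw [hpt, ker_aeval_piecewise_empty] at b₀
  exact le_of_eq_of_le (by norm_num) b₀

/-- **von zur Gathen's Lemma 2.3 at a point, height form**: if all `(m-1) × (m-1)`
subpermanents of an `m × m` matrix `a` over a domain `L ⊇ K` vanish (`m ≥ 3`, `char K ≠ 2`),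
then the prime `{f : f(a) = 0} ⊆ K[x_{ij}]` has height `≥ 5`.  Reduction to the main case: let
`k ≤ m - 2` be maximal with a nonzero `k × k` subpermanent (vzG: "if all `(n-2) × (n-2)`
permanents vanish on `C`, the claim follows by induction"; here the induction is replaced by
descending to the largest nonvanishing size); `k = 0` means `a = 0`, where the `m² ≥ 9`
coordinates give height `≥ 9`. [cite: Vonzurgathen1987, Lemma 2.3] -/
theorem five_le_height_of_vanishing (h2 : (2 : K) ≠ 0) (hι : 3 ≤ Fintype.card ι) (a : ι × ι → L)
    (hvan1 : ∀ r c, (Matrix.of fun r c => a (r, c)).subperm (· ≠ c) (· ≠ r) = 0) :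
    (5 : ℕ∞) ≤ (RingHom.ker (aeval (R := K) a)).height := by
  classical
  let Good : ℕ → Prop := fun j => ∃ Rw Cl : Finset ι, Rw.card = j ∧ Cl.card = j ∧
    (Matrix.of fun r c => a (r, c)).subperm (· ∈ Cl) (· ∈ Rw) ≠ 0
  have hGood0 : Good 0 := ⟨∅, ∅, rfl, rfl, by
    rw [Matrix.subperm_of_isEmpty _ (fun i => Finset.notMem_empty i)
      (fun j => Finset.notMem_empty j)]
    exact one_ne_zero⟩
  have hGoodm : ¬ Good (Fintype.card ι - 1) := by
    rintro ⟨Rw, Cl, hR, hC, hne⟩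
    obtain ⟨r, rfl⟩ := exists_eq_univ_erase_of_card (s := Rw) (by omega)
    obtain ⟨c, rfl⟩ := exists_eq_univ_erase_of_card (s := Cl) (by omega)
    apply hne
    rw [← hvan1 r c]
    exact Matrix.subperm_congr _ (fun i => by simp) (fun j => by simp)
  have hGk : Good (Nat.findGreatest Good (Fintype.card ι - 2)) :=
    Nat.findGreatest_spec (P := Good) (Nat.zero_le _) hGood0
  have hkle : Nat.findGreatest Good (Fintype.card ι - 2) ≤ Fintype.card ι - 2 :=
    Nat.findGreatest_le _
  have hGk1 : ¬ Good (Nat.findGreatest Good (Fintype.card ι - 2) + 1) := by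
    by_cases hk1 : Nat.findGreatest Good (Fintype.card ι - 2) + 1 ≤ Fintype.card ι - 2
    · exact Nat.findGreatest_is_greatest (Nat.lt_succ_self _) hk1
    · have h : Nat.findGreatest Good (Fintype.card ι - 2) + 1 = Fintype.card ι - 1 := by omega
      rw [h]
      exact hGoodm
  obtain ⟨Rw, Cl, hR, hC, hg⟩ := hGk
  have hvan : ∀ Rw' Cl' : Finset ι, Rw'.card = Rw.card + 1 → Cl'.card = Rw.card + 1 →
      (Matrix.of fun r c => a (r, c)).subperm (· ∈ Cl') (· ∈ Rw') = 0 := by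
    intro Rw' Cl' hR' hC'
    by_contra hne
    exact hGk1 ⟨Rw', Cl', by rw [hR', hR], by rw [hC', hR], hne⟩
  rcases Nat.eq_zero_or_pos (Nat.findGreatest Good (Fintype.card ι - 2)) with hk0 | hkpos
  · -- `k = 0`: all entries of `a` vanish
    have hR0 : Rw = ∅ := Finset.card_eq_zero.1 (by rw [hR, hk0])
    have hzero : ∀ x ∈ (Finset.univ : Finset (ι × ι)), a x = 0 := by
      rintro ⟨r, c⟩ -
      have h := hvan {r} {c} (by rw [hR0, Finset.card_singleton, Finset.card_empty])
        (by rw [hR0, Finset.card_singleton, Finset.card_empty])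
      rwa [subperm_singleton] at h
    refine le_trans ?_ (card_le_height_ker_aeval a Finset.univ hzero)
    rw [Finset.card_univ, Fintype.card_prod]
    have h9 : 3 * 3 ≤ Fintype.card ι * Fintype.card ι := Nat.mul_le_mul hι hι
    have h5 : 5 ≤ Fintype.card ι * Fintype.card ι := by omega
    exact_mod_cast h5
  · -- main case
    obtain ⟨j₃, hj₃⟩ : Cl.Nonempty := Finset.card_pos.1 (by rw [hC]; exact hkpos)
    obtain ⟨i₁, hi₁, i₂, hi₂, hi⟩ := Finset.one_lt_card.1 (show 1 < Rwᶜ.card by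
      rw [Finset.card_compl, hR]; omega)
    obtain ⟨j₁, hj₁, j₂, hj₂, hj⟩ := Finset.one_lt_card.1 (show 1 < Clᶜ.card by
      rw [Finset.card_compl, hC]; omega)
    rw [Finset.mem_compl] at hi₁ hi₂ hj₁ hj₂
    have hCl : Cl = insert j₃ (Cl.erase j₃) := (Finset.insert_erase hj₃).symm
    refine five_le_height_of_block h2 a (S' := Cl.erase j₃) hi hi₁ hi₂ hj
      (fun h => hj₁ (h ▸ hj₃)) (fun h => hj₂ (h ▸ hj₃))
      (fun h => hj₁ (Finset.mem_of_mem_erase h)) (fun h => hj₂ (Finset.mem_of_mem_erase h))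
      (Finset.notMem_erase j₃ Cl) ?_ ?_ hvan
    · rw [Finset.card_erase_of_mem hj₃, hC, hR]
      omega
    · rw [← hCl]
      exact hg

end Block

/-! ### The named fact -/

/-- **von zur Gathen 1987, Lemma 2.3 (height form) — PROVED**: over an algebraically closed field
of characteristic `≠ 2` and for `m ≥ 3`, every prime of `K[x_{ij}]` containing `per_m` and its
partial derivatives has height `≥ 5` (equivalently, every component of `sing P_m` has
dimension `≤ m² − 5`).  The proof follows vzG p. 92 at the generic point `a` of the prime
(`L = K[x]/P`): the hypothesis gives the vanishing of all `(m-1) × (m-1)` subpermanents of `a`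
(`pderiv_perPoly`), and `five_le_height_of_vanishing` produces an explicit chain of five primes
below `P = ker (f ↦ f(a))`.  Algebraic closedness is not used.
[cite: Vonzurgathen1987, Lemma 2.3] -/
theorem vonzurGathen1987_singPerm_height_holds : vonzurGathen1987_singPerm_height := by
  intro K _ _ h2 m hm P hP hle
  haveI := hP
  let a : Fin m × Fin m → MvPolynomial (Fin m × Fin m) K ⧸ P := fun x => Ideal.Quotient.mk P (X x)
  have hker : RingHom.ker (aeval (R := K) a) = P := by
    have h : (aeval (R := K) a : MvPolynomial (Fin m × Fin m) K →ₐ[K] _ ⧸ P) =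
        Ideal.Quotient.mkₐ K P :=
      MvPolynomial.algHom_ext fun x => by simp [a]
    ext f
    rw [RingHom.mem_ker, show aeval (R := K) a f = Ideal.Quotient.mk P f by rw [h]; rfl,
      Ideal.Quotient.eq_zero_iff_mem]
  have hvan1 : ∀ r c, (Matrix.of fun r c => a (r, c)).subperm (· ≠ c) (· ≠ r) = 0 := by
    intro r c
    rw [← aeval_subperm_X (K := K) a, ← pderiv_perPoly, ← RingHom.mem_ker, hker]
    exact hle (pderiv_perPoly_mem_singPermIdeal K m (r, c))
  rw [← hker]
  exact five_le_height_of_vanishing h2 (by rw [Fintype.card_fin]; exact hm) a hvan1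

end VonZurGathen

/-- **von zur Gathen 1987, Thm. 3.1 — now unconditional.**  With both height facts of
`VonZurGathenRegularity.lean` discharged (`vonzurGathen1987_submaximalMinors_height_holds` in
`VonZurGathenRegularityProofs.lean`, Eagon's theorem; `vonzurGathen1987_singPerm_height_holds`
above), the assembly `vonzurGathen1987_perm_detRepr_rank_of_height_facts` proves the named fact
`vonzurGathen1987_perm_detRepr_rank` of `LandsbergRessayreNormalForm.lean`: every polynomial
determinantal representation `per_m = det ∘ Ã` (`m ≥ 3`, `F` infinite of characteristic `≠ 2`)
has `rank Ã(v) ≥ n - 1` at every point `v`. [cite: Vonzurgathen1987, Thm. 3.1] -/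
theorem vonzurGathen1987_perm_detRepr_rank_holds : vonzurGathen1987_perm_detRepr_rank :=
  VonZurGathen.vonzurGathen1987_perm_detRepr_rank_of_height_facts
    VonZurGathen.vonzurGathen1987_submaximalMinors_height_holds
    VonZurGathen.vonzurGathen1987_singPerm_height_holds

end Literature.Computability.AlgebraicComplexity
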